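import Literature.NumberTheory.Sieve.LargestPrimeFactorCubicFrame
import HarnessLib

/-!
# Heath-Brown 2001 (PLMS), §§2, 4: expanding the sieve weight —
# `S₀ = ∑_{d ∣ Q} λ_d ∑_{K ∈ 𝒦} ∑_{α : N(K)d ∣ N(α)} 1/N(α)` (and the same for any weight)

Topic `Literature/NumberTheory/Sieve`; a PROVED structural layer (no named facts) under the named fact
`Irving2015_largestPrimeFactor_cubic` (`LargestPrimeFactorCubic.lean`), continuing `…Frame` (the sums
`S₀`, `S₁` over an arbitrary generator family `G`).  Source: D. R. Heath-Brown, *The largest prime factor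
of `X³ + 2`*, Proc. London Math. Soc. (3) 82 (2001) 554–596: the sieve weight of the pair `(K, L)`,
`KL = (α)`, is `∑_{d ∣ (Q, N(L))} λ_d` (p. 8), `N(L) = N(α)/N(K)`; §4 (p. 16) reorganises `S₀`, `S₁`
as sums over `d` and `K` of sums over the generators `α` with `N(K) d ∣ N(α)`: "we may take `d` to run
over all square-free values of `N(A)`, where `A ∣ R, L`", using that `N(K) = p > X^{3δ}` exceeds every
prime factor of `Q = ∏_{p' < X^δ} p'`, so that `d ∣ N(α)/p ⟺ d ∣ N(α)` for `d ∣ Q`, `p ∣ N(α)`.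

PROVED here, for any `G` and any weight `φ`:

* `coprime_of_dvd_sievePrimes` — `d ∣ Q`, `p ∈ 𝒦 ⇒ (d, p) = 1`;
* `wt_eq_sum_filter` — `∑_{d ∣ (N(α)/p, Q)} λ_d = ∑_{d ∣ Q, d ∣ N(α)} λ_d` for `p ∈ 𝒦`, `p ∣ N(α)`;
* **`sum_pairsG_wt_mul_eq`** — `∑_{(α,p)} (∑_{d ∣ (N(α)/p, Q)} λ_d) φ(α) = ∑_{d ∣ Q} λ_d ∑_{p ∈ 𝒦} ∑_{α ∈ G, pd ∣ N(α)} φ(α)`;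
* `S0sumG_eq_sum`, `S1sumG_eq_sum` — the cases `φ = 1/N(α)` and `φ = R_{(α)}`.

## References

* D. R. Heath-Brown, *The largest prime factor of `X³ + 2`*, Proc. London Math. Soc. (3) 82 (2001)
  554–596, §2 p. 8 and §4 p. 16. [`HeathBrown2001LargestPrimeFactorCubic`]

## Mathlib / tree search

Tree: `LargestPrimeFactorCubic.wt`, `lam`, `sievePrimes`, `kPrimes`, `mem_kPrimes`, `normNat`, `hbδ`
(`…Setup`), `HeathBrown2001.pairsG`, `S0sumG`, `S1sumG` (`…Frame`), `primesProdBelow`,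
`dvd_primesProdBelow_iff`, `primesProdBelow_ne_zero` (`SieveFramework`).  Mathlib:
`Nat.Coprime.dvd_of_dvd_mul_right`, `Nat.Coprime.mul_dvd_of_dvd_of_dvd`, `Finset.sum_comm`,
`Finset.sum_filter`.
-/

noncomputable section

open Finset Real

namespace Literature.NumberTheory.Sieve.HeathBrown2001

open LargestPrimeFactorCubic

/-! ### `d ∣ Q` is coprime to `p ∈ 𝒦` -/

/-- A divisor of `Q = ∏_{p' < X^δ} p'` is coprime to every `p ∈ 𝒦` (`p > X^{3δ} ≥ X^δ`).
[cite: HeathBrown2001LargestPrimeFactorCubic, §4 p. 16] -/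
theorem coprime_of_dvd_sievePrimes {X d p : ℕ} (hd : d ∣ sievePrimes X) (hp : p ∈ kPrimes X) :
    Nat.Coprime d p := by
  obtain ⟨hpP, hplo, -⟩ := mem_kPrimes hp
  rw [Nat.Coprime, Nat.gcd_comm, ← Nat.Coprime, hpP.coprime_iff_not_dvd]
  intro hpd
  have h1 : p ∣ sievePrimes X := hpd.trans hd
  rw [sievePrimes, dvd_primesProdBelow_iff hpP] at h1
  -- `X^δ ≤ X^{3δ}`
  have hδ := hbδ_pos
  rcases Nat.eq_zero_or_pos X with rfl | hX
  · simp [Real.zero_rpow hδ.ne'] at h1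
    exact absurd h1 (not_lt.mpr (Nat.cast_nonneg p))
  · have hX1 : (1 : ℝ) ≤ X := by exact_mod_cast hX
    have : (X : ℝ) ^ hbδ ≤ (X : ℝ) ^ (3 * hbδ) := Real.rpow_le_rpow_of_exponent_le hX1 (by linarith)
    linarith

/-! ### The sieve weight as a sum over `d ∣ Q`, `d ∣ N(α)` -/

/-- For `p ∈ 𝒦` with `p ∣ N(α)`: the divisors of `(N(α)/p, Q)` are the `d ∣ Q` with `d ∣ N(α)`.
[cite: HeathBrown2001LargestPrimeFactorCubic, §4 p. 16] -/
theorem divisors_gcd_eq_filter {X p : ℕ} (hp : p ∈ kPrimes X) {N : ℕ} (hpN : p ∣ N) :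
    ((N / p).gcd (sievePrimes X)).divisors = (sievePrimes X).divisors.filter fun d => d ∣ N := by
  have hQ0 : sievePrimes X ≠ 0 := primesProdBelow_ne_zero _
  have hp0 : 0 < p := (mem_kPrimes hp).1.pos
  ext d
  rw [Nat.mem_divisors, mem_filter, Nat.mem_divisors, Nat.dvd_gcd_iff]
  constructor
  · rintro ⟨⟨h1, h2⟩, -⟩
    exact ⟨⟨h2, hQ0⟩, h1.trans (Nat.div_dvd_of_dvd hpN)⟩
  · rintro ⟨⟨h2, -⟩, h1⟩
    refine ⟨⟨?_, h2⟩, Nat.gcd_ne_zero_right hQ0⟩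
    have hcop := coprime_of_dvd_sievePrimes h2 hp
    have : d ∣ N / p * p := by rwa [Nat.div_mul_cancel hpN]
    exact hcop.dvd_of_dvd_mul_right this

/-- **The weight, expanded**: `∑_{d ∣ (N(α)/p, Q)} λ_d = ∑_{d ∣ Q} [d ∣ N(α)] λ_d` for `p ∈ 𝒦`, `p ∣ N(α)`.
[cite: HeathBrown2001LargestPrimeFactorCubic, §2 p. 8 and §4 p. 16] -/
theorem wt_eq_sum_filter {X : ℕ} {v : ℕ × ℕ × ℕ} {p : ℕ} (hp : p ∈ kPrimes X) (hpN : p ∣ normNat v) :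
    wt X v p = ∑ d ∈ (sievePrimes X).divisors, if d ∣ normNat v then lam X d else 0 := by
  rw [wt, divisors_gcd_eq_filter hp hpN, sum_filter]

/-- `p ∣ N ∧ d ∣ N ↔ pd ∣ N` for `d ∣ Q`, `p ∈ 𝒦`. [folklore] -/
theorem dvd_and_dvd_iff_mul_dvd {X d p : ℕ} (hd : d ∣ sievePrimes X) (hp : p ∈ kPrimes X) (N : ℕ) :
    (p ∣ N ∧ d ∣ N) ↔ p * d ∣ N := by
  have hcop := coprime_of_dvd_sievePrimes hd hp
  constructor
  · rintro ⟨h1, h2⟩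
    exact (Nat.Coprime.symm hcop).mul_dvd_of_dvd_of_dvd h1 h2
  · intro h
    exact ⟨(dvd_mul_right p d).trans h, (dvd_mul_left d p).trans h⟩

/-! ### The expansion of `∑_{(α,p)} wt · φ` -/

/-- **`∑_{(α,p) ∈ pairsG} (∑_{d ∣ (N(α)/p, Q)} λ_d) φ(α) = ∑_{d ∣ Q} λ_d ∑_{p ∈ 𝒦} ∑_{α ∈ G, pd ∣ N(α)} φ(α)`**.
[cite: HeathBrown2001LargestPrimeFactorCubic, §4 p. 16] -/
theorem sum_pairsG_wt_mul_eq (X : ℕ) (G : Finset (ℕ × ℕ × ℕ)) (φ : (ℕ × ℕ × ℕ) → ℝ) :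
    ∑ vp ∈ pairsG X G, wt X vp.1 vp.2 * φ vp.1 =
      ∑ d ∈ (sievePrimes X).divisors, lam X d *
        ∑ p ∈ kPrimes X, ∑ v ∈ G.filter (fun v => p * d ∣ normNat v), φ v := by
  classical
  -- expand the weight on `pairsG`
  have h1 : ∑ vp ∈ pairsG X G, wt X vp.1 vp.2 * φ vp.1 =
      ∑ vp ∈ pairsG X G, ∑ d ∈ (sievePrimes X).divisors,
        (if d ∣ normNat vp.1 then lam X d else 0) * φ vp.1 := by
    refine sum_congr rfl fun vp hvp => ?_
    rw [pairsG, mem_filter, mem_product] at hvp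
    rw [wt_eq_sum_filter hvp.1.2 hvp.2, sum_mul]
  rw [h1]
  -- pass from `pairsG` to `G × 𝒦` with the indicator of `p ∣ N`
  have h2 : ∑ vp ∈ pairsG X G, ∑ d ∈ (sievePrimes X).divisors,
        (if d ∣ normNat vp.1 then lam X d else 0) * φ vp.1 =
      ∑ vp ∈ G ×ˢ kPrimes X, ∑ d ∈ (sievePrimes X).divisors,
        if vp.2 ∣ normNat vp.1 ∧ d ∣ normNat vp.1 then lam X d * φ vp.1 else 0 := by
    rw [pairsG, sum_filter]
    refine sum_congr rfl fun vp _ => ?_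
    split_ifs with hpv
    · refine sum_congr rfl fun d _ => ?_
      by_cases hd : d ∣ normNat vp.1
      · rw [if_pos hd, if_pos ⟨hpv, hd⟩]
      · rw [if_neg hd, if_neg (fun h => hd h.2), zero_mul]
    · symm
      refine sum_eq_zero fun d _ => ?_
      rw [if_neg (fun h => hpv h.1)]
  rw [h2, sum_comm]
  refine sum_congr rfl fun d hd => ?_
  have hdQ : d ∣ sievePrimes X := Nat.dvd_of_mem_divisors hd
  rw [sum_product, mul_sum, sum_comm]
  refine sum_congr rfl fun p hp => ?_
  rw [sum_filter, mul_sum]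
  refine sum_congr rfl fun v _ => ?_
  have hiff := dvd_and_dvd_iff_mul_dvd hdQ hp (normNat v)
  by_cases h : p * d ∣ normNat v
  · rw [if_pos h, if_pos (hiff.mpr h)]
  · rw [if_neg h, if_neg (fun h' => h (hiff.mp h')), mul_zero]

/-- **`S₀ = ∑_{d ∣ Q} λ_d ∑_{p ∈ 𝒦} ∑_{α ∈ G, pd ∣ N(α)} 1/N(α)`**.
[cite: HeathBrown2001LargestPrimeFactorCubic, §4 p. 16 (S₀)] -/
theorem S0sumG_eq_sum (X : ℕ) (G : Finset (ℕ × ℕ × ℕ)) :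
    S0sumG X G = ∑ d ∈ (sievePrimes X).divisors, lam X d *
      ∑ p ∈ kPrimes X, ∑ v ∈ G.filter (fun v => p * d ∣ normNat v), (1 : ℝ) / normNat v := by
  rw [S0sumG, ← sum_pairsG_wt_mul_eq]
  exact sum_congr rfl fun vp _ => by rw [mul_one_div]

/-- **`S₁ = ∑_{d ∣ Q} λ_d ∑_{p ∈ 𝒦} ∑_{α ∈ G, pd ∣ N(α)} R_{(α)}`**, `R_I = #𝒜_I − X/N(I)`.
[cite: HeathBrown2001LargestPrimeFactorCubic, §4 p. 16 (S₁)] -/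
theorem S1sumG_eq_sum (X : ℕ) (G : Finset (ℕ × ℕ × ℕ)) :
    S1sumG X G = ∑ d ∈ (sievePrimes X).divisors, lam X d *
      ∑ p ∈ kPrimes X, ∑ v ∈ G.filter (fun v => p * d ∣ normNat v),
        ((Acount X v : ℝ) - X / normNat v) := by
  rw [S1sumG, ← sum_pairsG_wt_mul_eq]

end Literature.NumberTheory.Sieve.HeathBrown2001
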